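/-
Copyright (c) 2026 the pub-hodgecm-mathlib formalisation cell (harness21).  Prover seat hodgecm-mathlib-K2E1-p11 (g2), Track B ∕ K2-LIT, h413 =
`stmt-HodgeConjecture-24833`, line `K2_E1_TraceFormulaBeta`, 5Res campaign «ENDGAME BY FAMILIES» ∕ ROADCARD §3′ (M2 v2, amendment #2 (228)), deal D4′d (ruling (235)(a)): the GLUE between
★ P1 `exists_entire_symbol_of_arch` (the arch scalar `s_h` acting on `V(χ, K′, ω)⊗H^z`) and ★ `K2E1SymbolPositivitySecondDifference` (the `hs0`∕`hnc` engines): the explicit normalised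
integral form of the symbol, the reduction `x₀ ∈ K`, the measure fact «a bump at `1` charges `{H(k₀·) ≠ 1}`», and the two arch letters ASSEMBLED for a non-negative bump.
-/
import Summits.HodgeConjecture.HodgeConjecture.Theorems.K2E1ChiSectionSpaceU2Defs              -- ★ rows 2–4 (K2-defs1): `chiSectionSpace`, `isChiSection_of_mem`; brings ★ `IsChiSection.borel_mul`, `flatSectionU`, adelic Iwasawa `_cm`
import Summits.HodgeConjecture.HodgeConjecture.Theorems.K2E1SphericalHeckeEigenSectionU2         -- ★ P5 (K2-defs1): `continuous_borelHeight_coe`, `borelHeight_coe_pos`, `borelHeight_eq_one_of_mem`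
import Summits.HodgeConjecture.HodgeConjecture.Theorems.K2E1SymbolPositivitySecondDifference    -- ★ p860148 (this seat): `integral_ne_zero_of_re_ge_half`, `exists_apply_ne_apply_of_secondDiff`
import Literature.NumberTheory.Automorphic.UnitaryGroupCuspIntegralSiegelMajorant               -- ★ `borelHeight_mul_of_mem_comap_standardMaximalCompactGL` (`H(g·k) = H(g)`)
import HarnessLib

/-!
# D4′d — `K2E1ArchSphericalTypeSymbolActionU2`: the arch symbol `s_h` of ★ P1 in the normalised-integral shape, `x₀ ∈ K`, «a bump at `1` charges `{H(k₀·) ≠ 1}`», and the letters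
# `hs0` (`s_h(z₀) ≠ 0`) ∕ `hnc` (`s_h` non-constant) assembled for every `(χ_∞, ω)`

Cell `pub/hodgecm-mathlib`, crux H413 = `stmt-HodgeConjecture-24833`, route `HCCMUnconditional`; dealer K2E1-plan (g7) §3′.1 amendment #2 (228)(i′) and ruling (235)(a) (FILE 2 of (222) =
K2-defs1's `K2E1ArchSymbolCirclePhaseU2`, consuming THIS file by name).  THEOREMS ONLY (no `def` ∕ `instance` ∕ `notation` ∕ named-fact hypothesis ∕ `sorry`); lane `--kind proof --supports
stmt-HodgeConjecture-24833 --as helper` (count-neutral; closes no socket).  Generic `(F, E, c)`, every rank `N` (the CM pair only for the hypothesis-free Iwasawa corollary).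
THE MATHEMATICS ([BernsteinLapid2019, §4 Claim 1]; [Langlands1976, §6]; [MoeglinWaldspurger1995, I.2.17, II.1.2]).  ★ P1 (K2-defs1 p860003) gives ONE entire `s` with the ACTION CLAUSE
`∫ h(y)·f_z^φ(x·y) dν_G = s(z)·f_z^φ(x)` for all `z`, all `φ ∈ V = chiSectionSpace χ K′ ω`, all `x` — (228)(i′) «`R(h)f_z^φ = s_h(z)·f_z^φ`, `s_h` independent of `φ`» IS that clause; here it is a
BINDER `hact`, so every symbol qualifies.  (§1) At any `(φ₀, x₀)` with `φ₀(x₀) ≠ 0`: **`s(z) = ∫ h(y)·Φ(y)·R(y)^z dν_G`**, `Φ := φ₀(x₀·)∕φ₀(x₀)`, `R := H(x₀·)∕H(x₀) > 0` — the shape of ★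
`K2E1SymbolPositivitySecondDifference`.  (§2) A non-zero `χ`-section does not vanish at some `k₀ ∈ K` (Iwasawa `x = bk`, `φ(bk) = χ(b₀₀)φ(k)`), and then `H(k₀) = 1`, `R = H(k₀·)`.  (§3) A
continuous `h` with `h(1) ≠ 0` CHARGES `{y | H(k₀y) ≠ 1}`: conjugating the archimedean torus ray (`1 ∈ closure{H > 1}`, ★ `one_mem_closure_setOf_one_lt_borelHeight_two∕_three`) by `k₀` and
`H(gk₀) = H(g)`; Haar open-positivity.  (§4) For a REAL NON-NEGATIVE compactly supported continuous `h` with `h(1) ≠ 0` whose support sits in `{Re(Φ·R^{z₀}) ≥ ½}` resp. `{Re Φ ≥ ½}`: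
**`s(z₀) ≠ 0`** (★ `integral_ne_zero_of_re_ge_half`) and **`∃ z₁ z₂, s z₁ ≠ s z₂`** (★ `exists_apply_ne_apply_of_secondDiff`, second difference at `σ = 0`), all five integrability binders
discharged (continuous integrands with compact support).  FILE 2 (K2-defs1) supplies such an `h = S_η η` as a pure tensor `K_∞`-central gauge bump and cites §4.
* §1 `cpow_div_ofReal`, **`symbol_eq_integral`**.  * §2 **`exists_apply_ne_zero_of_mem_K`** (Iwasawa letter), **`exists_apply_ne_zero_of_mem_K_cm`** (CM, hypothesis-free).
* §3 **`measure_setOf_ne_zero_and_borelHeight_ne_one_ne_zero`**.  * §4 **`symbol_ne_zero_of_re_ge_half`**, **`exists_symbol_ne_of_re_ge_half`**.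
HONEST LABEL.  Count-neutral helper; proves no printed statement; letter-free except the binders it is fed (`hact` = ★ P1's clause, `hcl` = ★ BL :332∕:58); HC_CM is proved only modulo the 7
printed citations (2 remaining named inputs: hLiu418 = `stmt-HodgeConjecture-24832`, h413 = `stmt-HodgeConjecture-24833`) until rung 0 closes.

## References
* [BernsteinLapid2019] J. Bernstein, E. Lapid, *On the meromorphic continuation of Eisenstein series*, J. AMS 37 (2024), §4 Claim 1.
* [Langlands1976] R. P. Langlands, *On the Functional Equations Satisfied by Eisenstein Series*, LNM 544 (1976), §6.
* [MoeglinWaldspurger1995] C. Mœglin, J.-L. Waldspurger, *Spectral decomposition and Eisenstein series* (1995), I.2.17, II.1.2.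
-/

set_option autoImplicit false
-- the mandated namespace repeats `HodgeConjecture.HodgeConjecture`, as in every `Theorems/*.lean` of this sub-problem
set_option linter.dupNamespace false

noncomputable section

open MeasureTheory MeasureTheory.Measure Set Filter Topology Complex NumberField
open scoped NNReal
open Literature.NumberTheory.Automorphic Literature.NumberTheory.Automorphic.UnitaryGroup AdelicGroupData
open Literature.NumberTheory.GaloisRepresentations (HeckeCharacter)
open Summit.HodgeConjecture.HodgeConjecture.Cruxes.H413.K2E1BorelEisensteinU
open Summit.HodgeConjecture.HodgeConjecture.Cruxes.H413.K2E1CharacterEisensteinU2Defs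
open Summit.HodgeConjecture.HodgeConjecture.Cruxes.H413.K2E1ChiSectionSpaceU2Defs
open Summit.HodgeConjecture.HodgeConjecture.Cruxes.H413.K2E1SphericalHeckeEigenSectionU2 (continuous_borelHeight_coe borelHeight_coe_pos borelHeight_eq_one_of_mem)
open Summit.HodgeConjecture.HodgeConjecture.Cruxes.H413.K2E1SymbolPositivitySecondDifference (integral_ne_zero_of_re_ge_half exists_apply_ne_apply_of_secondDiff)

namespace Summit.HodgeConjecture.HodgeConjecture.Cruxes.H413.K2E1ArchSphericalTypeSymbolActionU2

section Generic

variable {F E : Type} [Field F] [NumberField F] [Field E] [NumberField E] [Algebra F E] {c : E ≃ₐ[F] E} {N : ℕ} [NeZero N]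

/-! ## §1 The symbol as a normalised integral `s(z) = ∫ h·Φ·R^z` -/

/-- `(a∕b)^z = a^z·(b^z)⁻¹` for positive reals `a, b` read in `ℂ`. [folklore] -/
theorem cpow_div_ofReal {a b : ℝ} (ha : 0 < a) (hb : 0 < b) (z : ℂ) :
    ((((a / b : ℝ)) : ℂ)) ^ z = (((a : ℝ) : ℂ) ^ z) * ((((b : ℝ) : ℂ) ^ z))⁻¹ := by
  rw [div_eq_mul_inv, ofReal_mul, mul_cpow_ofReal_nonneg ha.le (inv_nonneg.2 hb.le), ofReal_inv,
    inv_cpow _ _ (by rw [arg_ofReal_of_nonneg hb.le]; exact Real.pi_pos.ne)]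

variable [MeasurableSpace (quasiSplit F E c N).Adelic]

/-- **THE SYMBOL AS A NORMALISED INTEGRAL.**  If `s` satisfies the action clause of ★ P1 at `(φ₀, x₀)` — `∫ h(y)·f_z^{φ₀}(x₀y) dν_G = s(z)·f_z^{φ₀}(x₀)` for all `z` — and `φ₀(x₀) ≠ 0`, then
`s(z) = ∫ h(y)·(φ₀(x₀y)∕φ₀(x₀))·(H(x₀y)∕H(x₀))^z dν_G(y)` — the shape `∫ h·Φ·R^z` of ★ `K2E1SymbolPositivitySecondDifference`. [cite: BernsteinLapid2019, §4 Claim 1] -/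
theorem symbol_eq_integral (νG : Measure (quasiSplit F E c N).Adelic) {h : (quasiSplit F E c N).Adelic → ℂ} {s : ℂ → ℂ} {φ₀ : (quasiSplit F E c N).Adelic → ℂ}
    {x₀ : (quasiSplit F E c N).Adelic} (hact : ∀ z : ℂ, ∫ y, h y * flatSectionU φ₀ z (x₀ * y) ∂νG = s z * flatSectionU φ₀ z x₀) (hx₀ : φ₀ x₀ ≠ 0) (z : ℂ) :
    s z = ∫ y, h y * ((φ₀ (x₀ * y) / φ₀ x₀) * ((((((borelHeight (x₀ * y) : ℝ≥0) : ℝ) / ((borelHeight x₀ : ℝ≥0) : ℝ) : ℝ)) : ℂ) ^ z)) ∂νG := by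
  have hH0 : (((borelHeight x₀ : ℝ≥0) : ℝ) : ℂ) ^ z ≠ 0 := fun h0 => (ofReal_ne_zero.2 (borelHeight_coe_pos x₀).ne') ((cpow_eq_zero_iff _ _).1 h0).1
  have hf0 : flatSectionU φ₀ z x₀ ≠ 0 := by
    rw [flatSectionU_apply]
    exact mul_ne_zero hx₀ hH0
  have hz : s z = (∫ y, h y * flatSectionU φ₀ z (x₀ * y) ∂νG) * (flatSectionU φ₀ z x₀)⁻¹ := by
    rw [hact z, mul_inv_cancel_right₀ hf0]
  rw [hz, ← integral_mul_const]
  refine integral_congr_ae (Eventually.of_forall fun y => ?_)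
  show h y * flatSectionU φ₀ z (x₀ * y) * (flatSectionU φ₀ z x₀)⁻¹ = h y * ((φ₀ (x₀ * y) / φ₀ x₀) * ((((((borelHeight (x₀ * y) : ℝ≥0) : ℝ) / ((borelHeight x₀ : ℝ≥0) : ℝ) : ℝ)) : ℂ) ^ z))
  rw [flatSectionU_apply, flatSectionU_apply, cpow_div_ofReal (borelHeight_coe_pos (x₀ * y)) (borelHeight_coe_pos x₀), mul_inv, div_eq_mul_inv]
  ring

/-! ## §2 A non-zero `χ`-section does not vanish somewhere on `K` -/

omit [MeasurableSpace (quasiSplit F E c N).Adelic] in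
/-- **`φ₀ ≠ 0 ⟹ φ₀(k₀) ≠ 0` FOR SOME `k₀ ∈ K`** (Iwasawa letter `hBK`: `x = bk`; `φ₀(bk) = χ(b₀₀)·φ₀(k)` for a `χ`-section and `χ(b₀₀) ≠ 0`). [cite: MoeglinWaldspurger1995, I.2.17, II.1.2] -/
theorem exists_apply_ne_zero_of_mem_K
    (hBK : ∀ g : (quasiSplit F E c N).Adelic, ∃ b ∈ borelAdelic F E c N, ∃ k : (quasiSplit F E c N).Adelic, adelicVal F E c N ((StdForm.antidiagonal N).over E) k ∈ standardMaximalCompactGL N E ∧ g = b * k)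
    {χ : HeckeCharacter E} {φ₀ : (quasiSplit F E c N).Adelic → ℂ} (hφ₀ : IsChiSection χ φ₀) (hne : ∃ x, φ₀ x ≠ 0) :
    ∃ k₀ : (quasiSplit F E c N).Adelic, adelicVal F E c N ((StdForm.antidiagonal N).over E) k₀ ∈ standardMaximalCompactGL N E ∧ φ₀ k₀ ≠ 0 := by
  obtain ⟨x, hx⟩ := hne
  obtain ⟨b, hb, k, hk, rfl⟩ := hBK x
  refine ⟨k, hk, fun h0 => hx ?_⟩
  rw [hφ₀.borel_mul hb k, h0, mul_zero]

/-! ## §3 A bump at `1` charges `{y | H(k₀·y) ≠ 1}` -/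

variable [BorelSpace (quasiSplit F E c N).Adelic]

omit [BorelSpace (quasiSplit F E c N).Adelic] in
/-- **A CONTINUOUS `h` WITH `h(1) ≠ 0` CHARGES `{y | H(k₀y) ≠ 1}`** (`k₀ ∈ K`, `μ` positive on opens): if `1 ∈ closure {g | 1 < H g}` (★ `one_mem_closure_setOf_one_lt_borelHeight_two∕_three`), then
`μ {y | h y ≠ 0 ∧ H(k₀y) ≠ 1} ≠ 0` — for `y = k₀⁻¹gk₀` one has `H(k₀y) = H(gk₀) = H(g)` (★ `borelHeight_mul_of_mem_comap_standardMaximalCompactGL`). [cite: BernsteinLapid2019, §4 Claim 2] -/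
theorem measure_setOf_ne_zero_and_borelHeight_ne_one_ne_zero (μ : Measure (quasiSplit F E c N).Adelic) [μ.IsOpenPosMeasure] {h : (quasiSplit F E c N).Adelic → ℝ} (hh : Continuous h) (h1 : h 1 ≠ 0)
    {k₀ : (quasiSplit F E c N).Adelic} (hk₀ : adelicVal F E c N ((StdForm.antidiagonal N).over E) k₀ ∈ standardMaximalCompactGL N E)
    (hcl : (1 : (quasiSplit F E c N).Adelic) ∈ closure {g : (quasiSplit F E c N).Adelic | 1 < borelHeight g}) :
    μ {y : (quasiSplit F E c N).Adelic | h y ≠ 0 ∧ ((borelHeight (k₀ * y) : ℝ≥0) : ℝ) ≠ 1} ≠ 0 := by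
  have hO : IsOpen {y : (quasiSplit F E c N).Adelic | h y ≠ 0 ∧ ((borelHeight (k₀ * y) : ℝ≥0) : ℝ) ≠ 1} :=
    (isOpen_ne_fun hh continuous_const).inter (isOpen_ne_fun (continuous_borelHeight_coe.comp (continuous_const.mul continuous_id)) continuous_const)
  -- a point of `{H > 1}` inside the open neighbourhood `{g | h (k₀⁻¹ g k₀) ≠ 0}` of `1`
  have hO' : IsOpen {g : (quasiSplit F E c N).Adelic | h (k₀⁻¹ * g * k₀) ≠ 0} := isOpen_ne_fun (hh.comp ((continuous_const.mul continuous_id).mul continuous_const)) continuous_const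
  have h1' : (1 : (quasiSplit F E c N).Adelic) ∈ {g : (quasiSplit F E c N).Adelic | h (k₀⁻¹ * g * k₀) ≠ 0} := by
    show h (k₀⁻¹ * 1 * k₀) ≠ 0
    rwa [mul_one, inv_mul_cancel]
  obtain ⟨g, hgO, hgH⟩ := mem_closure_iff.1 hcl _ hO' h1'
  have hmem : k₀⁻¹ * g * k₀ ∈ {y : (quasiSplit F E c N).Adelic | h y ≠ 0 ∧ ((borelHeight (k₀ * y) : ℝ≥0) : ℝ) ≠ 1} := by
    refine ⟨hgO, ?_⟩
    have hk : borelHeight (k₀ * (k₀⁻¹ * g * k₀)) = borelHeight g := by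
      rw [show k₀ * (k₀⁻¹ * g * k₀) = g * k₀ by group]
      exact borelHeight_mul_of_mem_comap_standardMaximalCompactGL (Subgroup.mem_comap.2 hk₀) g
    have hg1 : (1 : ℝ) < ((borelHeight g : ℝ≥0) : ℝ) := by exact_mod_cast (show 1 < borelHeight g from hgH)
    show ((borelHeight (k₀ * (k₀⁻¹ * g * k₀)) : ℝ≥0) : ℝ) ≠ 1
    rw [hk]
    exact hg1.ne'
  exact (hO.measure_pos μ ⟨_, hmem⟩).ne'

/-! ## §4 The two arch letters assembled for a non-negative bump -/

omit [MeasurableSpace (quasiSplit F E c N).Adelic] [BorelSpace (quasiSplit F E c N).Adelic] in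
/-- Continuity of the normalised integrand `y ↦ h(y)·(Φ(y)·H(k₀y)^z)` with `Φ = φ₀(k₀·)∕φ₀(k₀)`. [folklore] -/
theorem continuous_bump_mul_section_mul_cpow {h : (quasiSplit F E c N).Adelic → ℝ} (hh : Continuous h) {φ₀ : (quasiSplit F E c N).Adelic → ℂ} (hφc : Continuous φ₀) (k₀ : (quasiSplit F E c N).Adelic) (z : ℂ) :
    Continuous fun y : (quasiSplit F E c N).Adelic => (((h y : ℝ)) : ℂ) * ((φ₀ (k₀ * y) / φ₀ k₀) * ((((borelHeight (k₀ * y) : ℝ≥0) : ℝ) : ℂ) ^ z)) :=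
  (continuous_ofReal.comp hh).mul (((hφc.comp (continuous_const.mul continuous_id)).div_const _).mul
    ((continuous_ofReal.comp (continuous_borelHeight_coe.comp (continuous_const.mul continuous_id))).cpow continuous_const
      fun y => ofReal_mem_slitPlane.2 (borelHeight_coe_pos (k₀ * y))))

omit [BorelSpace (quasiSplit F E c N).Adelic] in
/-- With `x₀ = k₀ ∈ K` the ratio `H(k₀y)∕H(k₀)` is `H(k₀y)` (`H(k₀) = 1`). [folklore] -/
theorem symbol_eq_integral_of_mem_K (νG : Measure (quasiSplit F E c N).Adelic) {h : (quasiSplit F E c N).Adelic → ℂ} {s : ℂ → ℂ} {φ₀ : (quasiSplit F E c N).Adelic → ℂ} {k₀ : (quasiSplit F E c N).Adelic}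
    (hk₀ : adelicVal F E c N ((StdForm.antidiagonal N).over E) k₀ ∈ standardMaximalCompactGL N E)
    (hact : ∀ z : ℂ, ∫ y, h y * flatSectionU φ₀ z (k₀ * y) ∂νG = s z * flatSectionU φ₀ z k₀) (hx₀ : φ₀ k₀ ≠ 0) (z : ℂ) :
    s z = ∫ y, h y * ((φ₀ (k₀ * y) / φ₀ k₀) * ((((borelHeight (k₀ * y) : ℝ≥0) : ℝ) : ℂ) ^ z)) ∂νG := by
  rw [symbol_eq_integral νG hact hx₀ z]
  simp only [borelHeight_eq_one_of_mem hk₀, NNReal.coe_one, div_one]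

/-- **LETTER `hs0` — `s(z₀) ≠ 0`.**  For a REAL, non-negative, continuous, compactly supported bump `h` with `h(1) ≠ 0`, a continuous section `φ₀` with `φ₀(k₀) ≠ 0` (`k₀ ∈ K`), a symbol `s` with
★ P1's action clause at `(φ₀, k₀)`, and the support condition `Re((φ₀(k₀y)∕φ₀(k₀))·H(k₀y)^{z₀}) ≥ ½` on `{h ≠ 0}` (an open neighbourhood of `1`; FILE 2 puts the bump inside it):
`s(z₀) ≠ 0` (★ `integral_ne_zero_of_re_ge_half`; `∫ h > 0` by Haar open-positivity). [cite: BernsteinLapid2019, §4 Claim 1] -/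
theorem symbol_ne_zero_of_re_ge_half (νG : Measure (quasiSplit F E c N).Adelic) [IsFiniteMeasureOnCompacts νG] [νG.IsOpenPosMeasure]
    {h : (quasiSplit F E c N).Adelic → ℝ} (hh : Continuous h) (hhs : HasCompactSupport h) (h0 : ∀ y, 0 ≤ h y) (h1 : h 1 ≠ 0)
    {φ₀ : (quasiSplit F E c N).Adelic → ℂ} (hφc : Continuous φ₀) {k₀ : (quasiSplit F E c N).Adelic} (hk₀ : adelicVal F E c N ((StdForm.antidiagonal N).over E) k₀ ∈ standardMaximalCompactGL N E) (hx₀ : φ₀ k₀ ≠ 0)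
    {s : ℂ → ℂ} (hact : ∀ z : ℂ, ∫ y, (((h y : ℝ)) : ℂ) * flatSectionU φ₀ z (k₀ * y) ∂νG = s z * flatSectionU φ₀ z k₀) {z₀ : ℂ}
    (hW : ∀ y, h y ≠ 0 → (1 / 2 : ℝ) ≤ ((φ₀ (k₀ * y) / φ₀ k₀) * ((((borelHeight (k₀ * y) : ℝ≥0) : ℝ) : ℂ) ^ z₀)).re) :
    s z₀ ≠ 0 := by
  rw [symbol_eq_integral_of_mem_K νG hk₀ hact hx₀ z₀]
  have hpos : 0 < ∫ y, h y ∂νG := by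
    rw [integral_pos_iff_support_of_nonneg h0 (hh.integrable_of_hasCompactSupport hhs)]
    exact (isOpen_ne_fun hh continuous_const).measure_pos νG ⟨1, h1⟩
  exact integral_ne_zero_of_re_ge_half νG h0 hW (hh.integrable_of_hasCompactSupport hhs)
    ((continuous_bump_mul_section_mul_cpow hh hφc k₀ z₀).integrable_of_hasCompactSupport (hhs.comp_left ofReal_zero).mul_right) hpos

/-- **LETTER `hnc` — `s` IS NOT CONSTANT.**  Same data with the support condition `Re(φ₀(k₀y)∕φ₀(k₀)) ≥ ½` on `{h ≠ 0}` and `1 ∈ closure{H > 1}` (★ at `N = 2, 3`): `∃ z₁ z₂, s z₁ ≠ s z₂` — the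
second difference of `s` at `σ = 0` has positive real part (★ `exists_apply_ne_apply_of_secondDiff`; `h` charges `{H(k₀·) ≠ 1}` by §3). [cite: BernsteinLapid2019, §4 Claims 1–2] [cite: Langlands1976, §6] -/
theorem exists_symbol_ne_of_re_ge_half (νG : Measure (quasiSplit F E c N).Adelic) [IsFiniteMeasureOnCompacts νG] [νG.IsOpenPosMeasure]
    {h : (quasiSplit F E c N).Adelic → ℝ} (hh : Continuous h) (hhs : HasCompactSupport h) (h0 : ∀ y, 0 ≤ h y) (h1 : h 1 ≠ 0)
    {φ₀ : (quasiSplit F E c N).Adelic → ℂ} (hφc : Continuous φ₀) {k₀ : (quasiSplit F E c N).Adelic} (hk₀ : adelicVal F E c N ((StdForm.antidiagonal N).over E) k₀ ∈ standardMaximalCompactGL N E) (hx₀ : φ₀ k₀ ≠ 0)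
    {s : ℂ → ℂ} (hact : ∀ z : ℂ, ∫ y, (((h y : ℝ)) : ℂ) * flatSectionU φ₀ z (k₀ * y) ∂νG = s z * flatSectionU φ₀ z k₀)
    (hW : ∀ y, h y ≠ 0 → (1 / 2 : ℝ) ≤ (φ₀ (k₀ * y) / φ₀ k₀).re) (hcl : (1 : (quasiSplit F E c N).Adelic) ∈ closure {g : (quasiSplit F E c N).Adelic | 1 < borelHeight g}) :
    ∃ z₁ z₂ : ℂ, s z₁ ≠ s z₂ := by
  have hR : ∀ y : (quasiSplit F E c N).Adelic, 0 < ((borelHeight (k₀ * y) : ℝ≥0) : ℝ) := fun y => borelHeight_coe_pos (k₀ * y)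
  have hint : ∀ z : ℂ, Integrable (fun y : (quasiSplit F E c N).Adelic => (((h y : ℝ)) : ℂ) * ((φ₀ (k₀ * y) / φ₀ k₀) * ((((borelHeight (k₀ * y) : ℝ≥0) : ℝ) : ℂ) ^ z))) νG := fun z =>
    (continuous_bump_mul_section_mul_cpow hh hφc k₀ z).integrable_of_hasCompactSupport (hhs.comp_left ofReal_zero).mul_right
  have hs : ∀ z ∈ ({(((0 : ℝ) : ℂ)) + 1, (((0 : ℝ) : ℂ)) - 1, (((0 : ℝ) : ℂ))} : Set ℂ),
      s z = ∫ y, (((h y : ℝ)) : ℂ) * ((φ₀ (k₀ * y) / φ₀ k₀) * ((((borelHeight (k₀ * y) : ℝ≥0) : ℝ) : ℂ) ^ z)) ∂νG := fun z _ =>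
    symbol_eq_integral_of_mem_K νG hk₀ hact hx₀ z
  -- the real second-difference weight `h·(H^{-1}·(H − 1)²)` and its complex form are continuous with compact support
  have hwc : Continuous fun y : (quasiSplit F E c N).Adelic => h y * (((borelHeight (k₀ * y) : ℝ≥0) : ℝ) ^ ((0 : ℝ) - 1) * (((borelHeight (k₀ * y) : ℝ≥0) : ℝ) - 1) ^ 2) :=
    hh.mul (((continuous_borelHeight_coe.comp (continuous_const.mul continuous_id)).rpow_const fun y => Or.inl (hR y).ne').mul
      (((continuous_borelHeight_coe.comp (continuous_const.mul continuous_id)).sub continuous_const).pow 2))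
  have hwi : Integrable (fun y : (quasiSplit F E c N).Adelic => h y * (((borelHeight (k₀ * y) : ℝ≥0) : ℝ) ^ ((0 : ℝ) - 1) * (((borelHeight (k₀ * y) : ℝ≥0) : ℝ) - 1) ^ 2)) νG :=
    hwc.integrable_of_hasCompactSupport hhs.mul_right
  have haux : Continuous fun y : (quasiSplit F E c N).Adelic => ((((h y : ℝ)) : ℂ) * ((φ₀ (k₀ * y) / φ₀ k₀) * ((((borelHeight (k₀ * y) : ℝ≥0) : ℝ) : ℂ) ^ ((((0 : ℝ) : ℂ)) - 1)))) *
      ((((((borelHeight (k₀ * y) : ℝ≥0) : ℝ)) : ℂ) - 1) ^ 2) :=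
    (continuous_bump_mul_section_mul_cpow hh hφc k₀ ((((0 : ℝ) : ℂ)) - 1)).mul
      (((continuous_ofReal.comp (continuous_borelHeight_coe.comp (continuous_const.mul continuous_id))).sub continuous_const).pow 2)
  have hic : Continuous fun y : (quasiSplit F E c N).Adelic => (((h y : ℝ)) : ℂ) * ((φ₀ (k₀ * y) / φ₀ k₀) *
      (((((borelHeight (k₀ * y) : ℝ≥0) : ℝ) : ℂ) ^ ((((0 : ℝ) : ℂ)) - 1)) * (((((borelHeight (k₀ * y) : ℝ≥0) : ℝ)) : ℂ) - 1) ^ 2)) :=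
    haux.congr fun y => by ring
  exact exists_apply_ne_apply_of_secondDiff νG (h := h) (Φ := fun y : (quasiSplit F E c N).Adelic => φ₀ (k₀ * y) / φ₀ k₀) (R := fun y : (quasiSplit F E c N).Adelic => ((borelHeight (k₀ * y) : ℝ≥0) : ℝ))
    h0 hR hW 0 hs (hint ((((0 : ℝ) : ℂ)) + 1)) (hint ((((0 : ℝ) : ℂ)) - 1)) (hint (((0 : ℝ) : ℂ))) hwi
    (hic.integrable_of_hasCompactSupport (hhs.comp_left ofReal_zero).mul_right)
    (measure_setOf_ne_zero_and_borelHeight_ne_one_ne_zero νG hh h1 hk₀ hcl)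

end Generic

/-! ## §2′ The CM pair: the Iwasawa letter discharged -/

section CM

variable (L : Type) [Field L] [NumberField L] [IsCMField L] {N : ℕ} [NeZero N]

/-- **`φ₀ ≠ 0 ⟹ φ₀(k₀) ≠ 0` for some `k₀ ∈ K_U`, CM pair, hypothesis-free** (Iwasawa ★ `exists_mem_borelAdelic_mul_mem_standardMaximalCompactGL_cm`). [cite: MoeglinWaldspurger1995, I.2.17, II.1.2] -/
theorem exists_apply_ne_zero_of_mem_K_cm {χ : HeckeCharacter L} {φ₀ : (quasiSplit (↥(maximalRealSubfield L)) L (IsCMField.complexConj L) N).Adelic → ℂ}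
    (hφ₀ : IsChiSection χ φ₀) (hne : ∃ x, φ₀ x ≠ 0) :
    ∃ k₀ : (quasiSplit (↥(maximalRealSubfield L)) L (IsCMField.complexConj L) N).Adelic,
      adelicVal (↥(maximalRealSubfield L)) L (IsCMField.complexConj L) N ((StdForm.antidiagonal N).over L) k₀ ∈ standardMaximalCompactGL N L ∧ φ₀ k₀ ≠ 0 :=
  exists_apply_ne_zero_of_mem_K (exists_mem_borelAdelic_mul_mem_standardMaximalCompactGL_cm L) hφ₀ hne

end CM

end Summit.HodgeConjecture.HodgeConjecture.Cruxes.H413.K2E1ArchSphericalTypeSymbolActionU2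

end
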